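import Literature.Computability.Cryptography.Subexponential
import Literature.Computability.Complexity.OracleProofs
import HarnessLib

/-!
# SERF reducibility is reflexive (discharge of `SERFReducible.refl`)

Sibling proof file of `Subexponential.lean` (D-0014: a named fact `def X : Prop` is discharged as
`theorem X_holds : X`).  It discharges

* `Literature.Computability.Cryptography.SERFReducible.refl_holds : SERFReducible.refl` — for every
  parameterised problem `Q`, `SERFReducible Q Q` (Impagliazzo–Paturi–Zane).

Source.  R. Impagliazzo, R. Paturi, F. Zane, *Which problems have strongly exponential complexity?*,
FOCS 1998 (doi:10.1109/sfcs.1998.743516), p. 2 (= JCSS 63 (2001), §2.1), verbatim after the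
definition of SERF: «If such a reduction family exists, we say `A₁` is SERF-reducible to `A₂`.  Strong
many-one reducibility is a special case of SERF-reducibility.» and «If `m'(x) ≥ m(x)`, then `(A; m')`
is always strong many-one reducible to `(A; m)` by the identity function»; reflexivity is the case
`m' = m`: the identity is a strong many-one reduction of `(A; m)` to itself (`m(id x) = m(x) ∈ O(m(x))`,
`|id x| = |x|`), hence a SERF reduction, for every `ε > 0` (the family is constant in `ε`).

Formalisation.  Exactly the assembly of the tree's
`Literature.Computability.FineGrained.serfReducible_kSATClauseParam_kSATParam_holds`
(`FineGrained/SerfSNPProofs.lean`, a strong many-one reduction packaged as a SERF reduction) with the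
Karp map specialised to the identity: the one-query oracle algorithm `karpAlg id` of
`Complexity/OracleProofs.lean` (Ladner–Lynch–Selman: a many-one reduction is a one-query Turing
reduction) with its wrapped step machine `karpLift M`, `M` a polynomial-time machine for the identity
(`PolyTimeComputable.id`).  On the empty transcript the step machine runs in time `p(|x|) + 2|x| + 4`
(`outputsWithin_karpLift_query`), on a non-empty transcript in time `|input|`, linear in the transcript
(`outputsWithin_karpLift_answer`) — within the `SERFReducible` step bound `c · 2^{ε p(x)} · (|x|+1)^c ·
(ℓ+1)` with the factor `2^{ε p(x)}` unused; two rounds of fuel; the single query is `x` itself, of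
parameter `p(x) ≤ 1 · p(x)` and length `|x| ≤ 1 · (|x|+1)^1`.  THEOREMS ONLY (no definition, no named
fact, no `sorry`); net debt −1.

## References

* R. Impagliazzo, R. Paturi, F. Zane, *Which problems have strongly exponential complexity?*,
  J. Comput. System Sci. 63 (2001) 512–530, §2.1; FOCS 1998 version (doi:10.1109/sfcs.1998.743516),
  p. 2 (SE, SERF, «Strong many-one reducibility is a special case of SERF-reducibility», «strong
  many-one reducible … by the identity function»).  [IPZ2001]
* R. E. Ladner, N. A. Lynch, A. L. Selman, *A comparison of polynomial time reducibilities*,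
  Theoret. Comput. Sci. 1 (1975), p. 104 and Prop. 2.1 (a many-one reduction is a one-query Turing
  reduction).  [LadnerLynchSelman1975]
-/

namespace Literature.Computability.Cryptography

open _root_.Computability Turing Complexity

/-- A polynomial over `ℕ` is dominated by `C (n+1)^C` for some `C ≥ 1` (cf.
`Literature.Computability.FineGrained.exists_eval_le_mul_succ_pow`; re-proved here to keep the
imports of this file minimal). [cite: IPZ2001, §2.1] -/
private theorem exists_eval_le_mul_succ_pow' (s : Polynomial ℕ) :
    ∃ C : ℕ, 1 ≤ C ∧ ∀ n : ℕ, s.eval n ≤ C * (n + 1) ^ C := by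
  obtain ⟨c, k, h⟩ := exists_eval_le_mul_pow_add s
  refine ⟨2 * c + k + 1, by omega, fun n => (h n).trans ?_⟩
  have h1 : n ^ k ≤ (n + 1) ^ (2 * c + k + 1) :=
    (Nat.pow_le_pow_left (Nat.le_succ n) k).trans (Nat.pow_le_pow_right (Nat.succ_pos n) (by omega))
  have h2 : 1 ≤ (n + 1) ^ (2 * c + k + 1) := Nat.one_le_pow _ _ (Nat.succ_pos n)
  calc c * n ^ k + c ≤ c * (n + 1) ^ (2 * c + k + 1) + c * (n + 1) ^ (2 * c + k + 1) :=
        Nat.add_le_add (Nat.mul_le_mul_left c h1) (by simpa using Nat.mul_le_mul_left c h2)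
    _ = (2 * c) * (n + 1) ^ (2 * c + k + 1) := by ring
    _ ≤ (2 * c + k + 1) * (n + 1) ^ (2 * c + k + 1) := Nat.mul_le_mul_right _ (by omega)

/-- **Discharge of `SERFReducible.refl`** (Impagliazzo–Paturi–Zane, FOCS 1998 p. 2 = JCSS 2001 §2.1:
«Strong many-one reducibility is a special case of SERF-reducibility» and «`(A; m')` is always strong
many-one reducible to `(A; m)` by the identity function» when `m' ≥ m`, here `m' = m`): every
parameterised problem `Q` SERF-reduces to itself.  The reduction family does not depend on `ε`: it is
the one-query oracle algorithm `karpAlg id` (query the input itself, answer with the oracle's bit) with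
the step machine `karpLift M` for a polynomial-time identity machine `M`; its step function runs in time
`p(|x|) + 2|x| + 4` on the empty transcript and in time `|input|` (linear in the transcript) otherwise,
within the `SERFReducible` step bound; two rounds of fuel; the query `x` has parameter `p(x) ≤ 1 · p(x)`
and length `|x| ≤ 1 · (|x| + 1) ^ 1`. [cite: IPZ2001, §2.1] -/
theorem SERFReducible.refl_holds : SERFReducible.refl := by
  intro Q ε hε
  obtain ⟨p, Mr, hMr⟩ := (PolyTimeComputable.id (id : List Bool → List Bool) :
    PolyTimeComputable id id (id : List Bool → List Bool))
  obtain ⟨C₁, hC₁, hp⟩ := exists_eval_le_mul_succ_pow' p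
  -- the step time bound: query case `p(|x|) + 2|x| + 4`, answer case `|input|`; their sum bounds both
  let Tstep : List Bool × List (List Bool) → ℕ := fun q =>
    p.eval q.1.length + (2 * q.1.length + 4) +
      (boolPair q.1 ((encodingList Bool).listBool.encode q.2)).length
  have hT : ∀ (x : List Bool) (as : List (List Bool)),
      Tstep (x, as) ≤ (C₁ + 6) * (x.length + 1) ^ (C₁ + 6) *
        (((encodingList Bool).listBool.encode as).length + 1) := by
    intro x as
    have h1 : p.eval x.length + 4 * x.length + 6 ≤ (C₁ + 6) * (x.length + 1) ^ (C₁ + 6) := by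
      have e1 := hp x.length
      have e2 : (x.length + 1) ≤ (x.length + 1) ^ C₁ := by
        simpa using Nat.pow_le_pow_right (Nat.succ_pos x.length) hC₁
      have e3 : C₁ * (x.length + 1) ^ C₁ ≤ (C₁ + 6) * (x.length + 1) ^ (C₁ + 6) :=
        Nat.mul_le_mul (by omega) (Nat.pow_le_pow_right (Nat.succ_pos _) (by omega))
      have e4 : (x.length + 1) ^ C₁ ≤ (x.length + 1) ^ (C₁ + 6) :=
        Nat.pow_le_pow_right (Nat.succ_pos _) (by omega)
      nlinarith
    have h2 : 1 ≤ (C₁ + 6) * (x.length + 1) ^ (C₁ + 6) := Nat.one_le_iff_ne_zero.2 (by positivity)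
    have h3 : Tstep (x, as) = p.eval x.length + 4 * x.length + 6 +
        ((encodingList Bool).listBool.encode as).length := by
      simp only [Tstep, length_boolPair]; omega
    rw [h3]
    nlinarith
  refine ⟨karpAlg id, fun _ => 2, Tstep, 1, ⟨2, fun x => ?_⟩,
    ⟨karpLift Mr, ?_⟩, ⟨C₁ + 6, fun x as => ?_⟩, fun x => ?_, fun x q hq => ?_⟩
  · -- the round budget `2` is subexponential
    have h2 : (1 : ℝ) ≤ (2 : ℝ) ^ (ε * (Q.param x : ℝ)) :=
      Real.one_le_rpow one_le_two (by positivity)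
    have h3 : (1 : ℝ) ≤ ((x.length : ℝ) + 1) ^ (2 : ℕ) :=
      one_le_pow₀ (by linarith [Nat.cast_nonneg (α := ℝ) x.length])
    calc (((fun _ : List Bool => (2 : ℕ)) x : ℕ) : ℝ) = 2 * 1 * 1 := by norm_num
      _ ≤ (2 : ℕ) * (2 : ℝ) ^ (ε * (Q.param x : ℝ)) * ((x.length : ℝ) + 1) ^ (2 : ℕ) := by
        push_cast; gcongr
  · -- the step machine
    rintro ⟨x, _ | ⟨a, as⟩⟩
    · change (karpLift Mr).OutputsWithin (boolPair x ((encodingList Bool).listBool.encode []))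
        (false :: id x) (Tstep (x, []))
      rw [listBool_encode_nil]
      refine (outputsWithin_karpLift_query Mr (hMr x)).mono ?_
      simp only [Tstep, id, listBool_encode_nil]
      omega
    · change (karpLift Mr).OutputsWithin (boolPair x ((encodingList Bool).listBool.encode (a :: as)))
        [true, a.headD false] (Tstep (x, a :: as))
      refine (outputsWithin_karpLift_answer Mr x a as).mono ?_
      simp only [Tstep]
      omega
  · -- the step time is within the SERF bound (the factor `2^{ε p(x)}` is not even used)
    have h1 : (Tstep (x, as) : ℝ) ≤ ((C₁ + 6 : ℕ) : ℝ) * ((x.length : ℝ) + 1) ^ (C₁ + 6) *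
        ((((encodingList Bool).listBool.encode as).length : ℝ) + 1) := by
      exact_mod_cast hT x as
    refine h1.trans ?_
    have h2 : (1 : ℝ) ≤ (2 : ℝ) ^ (ε * (Q.param x : ℝ)) :=
      Real.one_le_rpow one_le_two (by positivity)
    calc ((C₁ + 6 : ℕ) : ℝ) * ((x.length : ℝ) + 1) ^ (C₁ + 6) *
          ((((encodingList Bool).listBool.encode as).length : ℝ) + 1)
        = ((C₁ + 6 : ℕ) : ℝ) * 1 * ((x.length : ℝ) + 1) ^ (C₁ + 6) *
          ((((encodingList Bool).listBool.encode as).length : ℝ) + 1) := by ring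
      _ ≤ ((C₁ + 6 : ℕ) : ℝ) * (2 : ℝ) ^ (ε * (Q.param x : ℝ)) *
          ((x.length : ℝ) + 1) ^ (C₁ + 6) *
          ((((encodingList Bool).listBool.encode as).length : ℝ) + 1) := by gcongr
  · -- the run: one query (the input itself), the oracle's answer bit is the answer
    have hrun : (karpAlg id).run (Oracle.ofLanguage Q.lang) 2 x =
        some (((Oracle.ofLanguage Q.lang) (id x)).headD false) :=
      run_karpAlg id _ 0 x
    rw [hrun, Oracle.ofLanguage_apply]
    rfl
  · -- the query: parameter `≤ 1 · p(x)`, length `≤ 1 · (|x| + 1) ^ 1`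
    have hq' : q = x := by
      have hqs : (karpAlg id).queries (Oracle.ofLanguage Q.lang) 2 x = [id x] :=
        queries_karpAlg id _ 0 x
      rw [hqs, List.mem_singleton] at hq
      exact hq
    subst hq'
    constructor
    · omega
    · simp

end Literature.Computability.Cryptography
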